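import Literature.Analysis.FunctionSpaces.BochnerProofs
import HarnessLib

/-!
# Ventures/CertifiedManyBodySolver — Transport/SpectralMeasureKernelCeiling.lean

HONEST FRAMING: first certified bounds; not a superconductivity verdict; every number certified or labelled float.

The KERNEL CEILING on the atoms of a measure representing a positive-definite lattice function
(companion of `Literature.Analysis.FunctionSpaces.IsPositiveDefinite.exists_measure_integral_exp_eq`,
Herglotz's theorem on `ℤᵈ`): if `μ` is a finite measure on `ℝᵈ` with `∫ exp (i r·ξ) dμ = C r` for all
`r ∈ ℤᵈ`, `k` a finitely supported real kernel whose trigonometric polynomial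
`K (p) = ∑_r k r cos (r·p)` is pointwise nonnegative (e.g. a Fejér kernel), and `Q ∈ ℝᵈ`, then
`K (0) · μ (Q + 2πℤᵈ) ≤ ∑_r k r · Re (e^{-i r·Q} C r)` — the atom of the spectral measure at the
frequency `Q` (a long-range-order parameter when `C` is a correlation function of a translation-invariant
state) is bounded by a FINITE WINDOW SUM of `C`. Intended consumer: thermodynamic-limit structure-factor /
Néel-order ceilings from certified correlator windows (LEAN-MAP §5 G2; not instantiated in this file).
Pure measure theory; no states, no named fact, no sorry.
-/

noncomputable section

namespace Summit.Ventures.CertifiedManyBodySolver.Transport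

open MeasureTheory Complex Filter Topology
open scoped Real

/-! ### §1. Trigonometric moments of a representing measure; §2. the kernel ceiling -/


/-- For a representing measure, `Re (e^{-iα} C r) = ∫ cos (r·ξ - α) dμ`. -/
theorem integral_cos_sub_eq {d : ℕ} {C : (Fin d → ℤ) → ℂ} (μ : Measure (EuclideanSpace ℝ (Fin d)))
    [IsFiniteMeasure μ]
    (hμ : ∀ r : Fin d → ℤ, ∫ ξ, exp ((∑ i, (r i : ℝ) * ξ i : ℝ) * I) ∂μ = C r)
    (r : Fin d → ℤ) (α : ℝ) :
    ∫ ξ, Real.cos ((∑ i, (r i : ℝ) * ξ i) - α) ∂μ =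
      Real.cos α * (C r).re + Real.sin α * (C r).im := by
  have hcont : Continuous fun ξ : EuclideanSpace ℝ (Fin d) => (∑ i, (r i : ℝ) * ξ i : ℝ) := by
    fun_prop
  have hexp_int : Integrable (fun ξ : EuclideanSpace ℝ (Fin d) =>
      exp ((∑ i, (r i : ℝ) * ξ i : ℝ) * I)) μ := by
    refine Integrable.mono' (integrable_const (1 : ℝ)) ?_ (ae_of_all _ fun ξ => ?_)
    · exact (Complex.continuous_exp.comp
        ((Complex.continuous_ofReal.comp hcont).mul continuous_const)).aestronglyMeasurable
    · rw [Complex.norm_exp_ofReal_mul_I]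
  have hre : ∫ ξ, Real.cos (∑ i, (r i : ℝ) * ξ i) ∂μ = (C r).re := by
    rw [← hμ r]
    have h := integral_re hexp_int
    simp only [RCLike.re_to_complex] at h
    rw [← h]
    refine integral_congr_ae (ae_of_all _ fun ξ => ?_)
    simp only [Complex.exp_ofReal_mul_I_re]
  have him : ∫ ξ, Real.sin (∑ i, (r i : ℝ) * ξ i) ∂μ = (C r).im := by
    rw [← hμ r]
    have h := integral_im hexp_int
    simp only [RCLike.im_to_complex] at h
    rw [← h]
    refine integral_congr_ae (ae_of_all _ fun ξ => ?_)
    simp only [Complex.exp_ofReal_mul_I_im]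
  have hcos_int : Integrable (fun ξ : EuclideanSpace ℝ (Fin d) =>
      Real.cos (∑ i, (r i : ℝ) * ξ i)) μ :=
    Integrable.mono' (integrable_const (1 : ℝ)) (Real.continuous_cos.comp hcont).aestronglyMeasurable
      (ae_of_all _ fun ξ => by simpa using Real.abs_cos_le_one _)
  have hsin_int : Integrable (fun ξ : EuclideanSpace ℝ (Fin d) =>
      Real.sin (∑ i, (r i : ℝ) * ξ i)) μ :=
    Integrable.mono' (integrable_const (1 : ℝ)) (Real.continuous_sin.comp hcont).aestronglyMeasurable
      (ae_of_all _ fun ξ => by simpa using Real.abs_sin_le_one _)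
  simp_rw [Real.cos_sub]
  rw [integral_add (hcos_int.mul_const _) (hsin_int.mul_const _), integral_mul_const,
    integral_mul_const, hre, him]
  ring


/-- **Kernel ceiling** on the atoms of a measure representing `C`. Let `μ` be a finite measure on
`ℝᵈ` with `∫ exp (i r·ξ) dμ = C r` for all `r ∈ ℤᵈ` (e.g. from
`IsPositiveDefinite.exists_measure_integral_exp_eq`), `k` a finitely supported real kernel on `ℤᵈ`
whose trigonometric polynomial `K (p) = ∑_r k r cos (r·p)` is pointwise nonnegative, and `Q ∈ ℝᵈ`.
Then `K (0) · μ (Q + 2πℤᵈ) ≤ ∑_r k r · Re (e^{-i r·Q} C r)`: since `K ≥ 0` and `K = K (0)` on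
`Q + 2πℤᵈ`, `K(0) μ(Q + 2πℤᵈ) ≤ ∫ K (ξ - Q) dμ = ∑_r k r ∫ cos (r·(ξ - Q)) dμ`. (With the Fejér
kernel this bounds the atom of the spectral measure at `Q` — e.g. a long-range-order parameter — by a
finite window sum of `C`.) -/
theorem kernel_ceiling_of_integral_exp_eq {d : ℕ} {C : (Fin d → ℤ) → ℂ}
    (μ : Measure (EuclideanSpace ℝ (Fin d))) [IsFiniteMeasure μ]
    (hμ : ∀ r : Fin d → ℤ, ∫ ξ, exp ((∑ i, (r i : ℝ) * ξ i : ℝ) * I) ∂μ = C r)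
    (k : (Fin d → ℤ) →₀ ℝ) (Q : Fin d → ℝ)
    (hK : ∀ p : Fin d → ℝ, 0 ≤ ∑ r ∈ k.support, k r * Real.cos (∑ i, (r i : ℝ) * p i)) :
    (∑ r ∈ k.support, k r) * (μ {ξ | ∃ m : Fin d → ℤ, ∀ i, ξ i = Q i + 2 * π * m i}).toReal
      ≤ ∑ r ∈ k.support, k r * (Real.cos (∑ i, (r i : ℝ) * Q i) * (C r).re
                                 + Real.sin (∑ i, (r i : ℝ) * Q i) * (C r).im) := by
  set A : Set (EuclideanSpace ℝ (Fin d)) := {ξ | ∃ m : Fin d → ℤ, ∀ i, ξ i = Q i + 2 * π * m i}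
    with hA
  -- the shifted kernel `K (ξ - Q)`
  set K : EuclideanSpace ℝ (Fin d) → ℝ :=
    fun ξ => ∑ r ∈ k.support, k r * Real.cos ((∑ i, (r i : ℝ) * ξ i) - ∑ i, (r i : ℝ) * Q i) with hKdef
  have hKnn : ∀ ξ, 0 ≤ K ξ := by
    intro ξ
    have h := hK (fun i => ξ i - Q i)
    simp only [hKdef]
    convert h using 2 with r _
    congr 1
    rw [← Finset.sum_sub_distrib]
    exact congrArg Real.cos (Finset.sum_congr rfl fun i _ => by ring)
  have hKcont : Continuous K := by
    simp only [hKdef]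
    fun_prop
  have hKbd : ∀ ξ, ‖K ξ‖ ≤ ∑ r ∈ k.support, |k r| := by
    intro ξ
    simp only [hKdef, Real.norm_eq_abs]
    refine (Finset.abs_sum_le_sum_abs _ _).trans (Finset.sum_le_sum fun r _ => ?_)
    rw [abs_mul]
    exact mul_le_of_le_one_right (abs_nonneg _) (Real.abs_cos_le_one _)
  have hKint : Integrable K μ :=
    Integrable.mono' (integrable_const _) hKcont.aestronglyMeasurable (ae_of_all _ hKbd)
  -- on `A` the kernel equals `K(0) = ∑ k r`
  have hKA : ∀ ξ ∈ A, K ξ = ∑ r ∈ k.support, k r := by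
    rintro ξ ⟨m, hm⟩
    simp only [hKdef]
    refine Finset.sum_congr rfl fun r _ => ?_
    have : (∑ i, (r i : ℝ) * ξ i) - ∑ i, (r i : ℝ) * Q i = ((∑ i, r i * m i : ℤ) : ℝ) * (2 * π) := by
      rw [← Finset.sum_sub_distrib]
      push_cast
      rw [Finset.sum_mul]
      exact Finset.sum_congr rfl fun i _ => by rw [hm i]; ring
    rw [this, Real.cos_int_mul_two_pi, mul_one]
  have hAmeas : MeasurableSet A := by
    have hAeq : A = ⋃ m : Fin d → ℤ,
        (fun ξ : EuclideanSpace ℝ (Fin d) => fun i => ξ i) ⁻¹' {fun i => Q i + 2 * π * m i} := by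
      ext ξ
      simp only [hA, Set.mem_setOf_eq, Set.mem_iUnion, Set.mem_preimage, Set.mem_singleton_iff,
        funext_iff]
    rw [hAeq]
    refine MeasurableSet.iUnion fun m => ?_
    exact (measurable_pi_lambda _ fun i => by fun_prop) (measurableSet_singleton _)
  -- the chain of (in)equalities
  calc (∑ r ∈ k.support, k r) * (μ A).toReal
      = ∫ ξ in A, (∑ r ∈ k.support, k r) ∂μ := by
        rw [setIntegral_const, Measure.real, smul_eq_mul, mul_comm]
    _ = ∫ ξ in A, K ξ ∂μ := setIntegral_congr_fun hAmeas fun ξ hξ => (hKA ξ hξ).symm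
    _ ≤ ∫ ξ, K ξ ∂μ := setIntegral_le_integral hKint (ae_of_all _ hKnn)
    _ = ∑ r ∈ k.support, k r * ∫ ξ, Real.cos ((∑ i, (r i : ℝ) * ξ i) - ∑ i, (r i : ℝ) * Q i) ∂μ := by
        simp only [hKdef]
        rw [integral_finsetSum _ (fun r _ => ?_)]
        · exact Finset.sum_congr rfl fun r _ => integral_const_mul _ _
        · refine (Integrable.mono' (integrable_const (1 : ℝ)) ?_ (ae_of_all _ fun ξ => ?_)).const_mul _
          · exact (Real.continuous_cos.comp (by fun_prop)).aestronglyMeasurable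
          · simpa using Real.abs_cos_le_one _
    _ = _ := Finset.sum_congr rfl fun r _ => by rw [integral_cos_sub_eq μ hμ r]

end Summit.Ventures.CertifiedManyBodySolver.Transport
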